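import Summits.ABC.ABC.Theses.DefiniteXi
import Summits.ABC.ABC.Theorems.DefiniteXiFreyModularity
import Summits.ABC.ABC.Theorems.DefiniteXiDefiniteRTControlPrimeSmulTransportDeg
import Summits.ABC.ABC.Theorems.DefiniteXiDefiniteRTControlPrimeValTransport
import Summits.ABC.ABC.Theorems.DefiniteXiDefiniteRTControlPrimeFreyScale
import Summits.ABC.ABC.Theorems.DefiniteXiDefiniteRTControlPrimeFreyLocal
import Literature.NumberTheory.EllipticCurves.TakahashiDegreeFormulaCoprimeProofs
import Literature.NumberTheory.EllipticCurves.PastenSpectralDegree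
import Literature.NumberTheory.EllipticCurves.PastenHeightBounds
import Literature.NumberTheory.EllipticCurves.PastenHeightBoundsLemma68LocalProofs
import Literature.NumberTheory.EllipticCurves.PastenSpectralDegreeIsogenyBoundProofs
import Literature.NumberTheory.EllipticCurves.ModularCurveManinSemistableBridgeProofs
import Literature.NumberTheory.EllipticCurves.ModularDegreeMinimal
import Literature.NumberTheory.EllipticCurves.IsogenyVariableChangeProofs
import Literature.NumberTheory.EllipticCurves.IsogenyCompProofs
import Literature.NumberTheory.EllipticCurves.IsogenyDualProofs
import HarnessLib

/-!
# Route DefiniteXi, crux `DefiniteRTControlPrime` (stmt-ABC-11338): the definite Ribet–Takahashi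
# control at a prime `N⁻ = q`, from the three vendored named facts

`DefiniteRTControlPrime`: for every `ε > 0` there is `C` such that for all coprime `a, b` with
`ab(a+b) ≠ 0`, `N` the conductor of the Frey curve `E = freyCurve a b`, every odd prime `q ∣ N`
and every datum `D` of minimal degree among the modular parametrisation data of the MODEL
`freyCurve a b` at level `N`:
`deg D ≤ C · N^ε · brandtXi (N/q) q (a(E)) · v_q(Δ_min(E))`.

This file proves it CONDITIONALLY on exactly the three named facts of the literature that carry
the deep geometry (`definiteRTControlPrime_of_facts`; line `Sketch` = card `optimal-pivot-spine` of
the crux programme, skeleton `Cruxes/DefiniteRTControlPrime/Lines/Sketch.lean`):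
`takahashi2001_thm_2_3_of_coprime` (Takahashi 2001, Thm. 2.3 at `r ∥ N`: Néron models of `J₀(N)`,
Grothendieck's monodromy pairing, Ribet's isometry), `PastenShimura2024_minimalDegree_le_163_mul`
(Pasten 2024 §3 p. 13: Mazur–Kenku and the Néron mapping property) and `PastenShimura2024_lemma_6_8`
(Pasten 2024 Lemma 6.8: component groups in an isogeny class).  Everything else is proved in the
tree: the four bookkeeping stubs of the skeleton (`stub_freyLocal`, `stub_valTransport`,
`stub_smulTransportDeg`, `stub_freyScale`, landed as `Theorems/DefiniteXiDefiniteRTControlPrime*.lean`)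
and the two helpers below.

## Composition (`C = 4·163²`, the `N^ε` is idle)

Write `N = M q`; Frey curves are multiplicative at every odd bad prime, so `gcd(M, q) = 1`
(`stub_freyLocal`).  Let `W_m = C • E` be a global minimal model (`hasGlobalMinimalModel_rat_holds`),
`D₁` a datum of `W_m` of minimal degree (data of `E` transport to `W_m`), `f₁ := D₁.f`,
`(W₀, D₀)` the lattice-optimal datum of the class (`exists_optimalDatum'`, minimal among ALL data
with newform `f₁` by `modularDegree_le_of_isogenyMap_ker_eq_bot`), and `(W⋆, P⋆)` a datum of
minimal degree among the data, at level `N`, of the conductor-`N` curves with newform `f₁`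
(`exists_conductorMinimal`, a minimum over a nonempty set of naturals; nonempty because of
`(W_m, D₁)`).  Then
* `deg D ≤ deg D₁' = (num u_C)² · deg D₁ ≤ 4 · deg D₁` — `D₁'` the transport of `D₁` back to the
  Frey model WITH its degree (`stub_smulTransportDeg`), `|num u_C| ≤ 2` (`stub_freyScale`), and
  minimality of `D`;
* `deg D₁ ≤ 163 · deg D₀` — `PastenShimura2024_minimalDegree_le_163_mul`;
* `deg D₀ ≤ deg P⋆` — class-minimality of `D₀`;
* `deg P⋆ ≤ ξ(M, q)(a(W⋆)) · v_q(Δ_min(W⋆))` — `takahashi2001_thm_2_3_of_coprime` through the tree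
  corollary `takahashi2001_thm_2_3_of_coprime.modularDegree_le_brandtXi_mul` (setups of type
  `(M, q)` exist: `.nonempty_xiSetup'`), and `a(W⋆) = a(f₁) = a(W_m) = a(E)` (`LFunction_smul`);
* `v_q(Δ_min(W⋆)) ≤ 163 · v_q(Δ_min(E))` — `stub_valTransport` from `PastenShimura2024_lemma_6_8`
  along the `ℚ`-isogeny `E ~ W_m ~ W⋆` (`isIsogenous_smul`, `isIsogenous_of_f_eq`).

## References

* [Takahashi2001] S. Takahashi, J. Number Theory 90 (2001) 74–88, Thm. 2.3 (p. 79), p. 80, Thm. 3.8 (p. 84).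
* [PastenShimura2024] H. Pasten, Shimura curves and the abc conjecture, J. Number Theory 254 (2024)
  = arXiv:1705.09251, §3 p. 13, Lemma 6.8 p. 22.
* [Mazur1978] B. Mazur, Invent. Math. 44 (1978); [Kenku1982] M. A. Kenku, J. Number Theory 15 (1982).
-/

set_option linter.dupNamespace false

noncomputable section

namespace Summit.ABC.ABC.Theorems.DefiniteRTControlPrime

open Summit.ABC.ABC.Theses.DefiniteXi
open Literature.NumberTheory.EllipticCurves Literature.NumberTheory.EllipticCurves.ModularForms
open Literature.NumberTheory.Automorphic
open WeierstrassCurve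

/-! ## Proved helpers of the composition -/

/-- **Two elliptic curves over `ℚ` carrying parametrisation data with the same newform are
`ℚ`-isogenous**: both are isogenous to the lattice-optimal curve `W₀` of the class
(`exists_optimalDatum'`: `Λ_{W₀} = c₀ Λ_f`) along the analytic maps `z ↦ (c/c₀) z`
(`isIsogenous_of_forall_mul_mem_lattice`). [folklore] -/
theorem isIsogenous_of_f_eq {W W' : WeierstrassCurve ℚ} [W.IsElliptic] [W'.IsElliptic] {N : ℕ}
    [NeZero N] (D : ModularParametrizationData W N) (D' : ModularParametrizationData W' N)
    (hf : D'.f = D.f) : W.IsIsogenous W' := by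
  obtain ⟨W₀, hW₀, D₀, hf₀, h₀⟩ := D.exists_optimalDatum'
  haveI := hW₀
  have key : ∀ {V : WeierstrassCurve ℚ} [V.IsElliptic] (P : ModularParametrizationData V N),
      P.f = D₀.f → W₀.IsIsogenous V := by
    intro V _ P hP
    have hc₀ : (D₀.c : ℚ) ≠ 0 := by exact_mod_cast D₀.maninConstant_ne_zero_holds
    have hc : (P.c : ℚ) ≠ 0 := by exact_mod_cast P.maninConstant_ne_zero_holds
    refine isIsogenous_of_forall_mul_mem_lattice D₀.isNeronLattice.1 D₀.isNeronLattice.2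
      P.isNeronLattice.1 P.isNeronLattice.2 (c := (P.c : ℚ) / D₀.c) (div_ne_zero hc hc₀) ?_
    intro z hz
    obtain ⟨w, hw, rfl⟩ := h₀ z hz
    have hw' : w ∈ periodLattice P.f := by rw [hP]; exact hw
    have : (((P.c : ℚ) / D₀.c : ℚ) : ℂ) * ((D₀.c : ℂ) * w) = (P.c : ℂ) * w := by
      have hc₀' : (D₀.c : ℂ) ≠ 0 := D₀.cast_c_ne_zero
      push_cast
      field_simp
    rw [this]
    exact P.smul_periodLattice_le w hw'
  have h1 : W₀.IsIsogenous W := key D hf₀.symm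
  have h2 : W₀.IsIsogenous W' := key D' (hf.trans hf₀.symm)
  exact h1.symm_of_charZero.trans' h2

/-- **The conductor-restricted optimal pivot.** Given a datum `D₁` of a conductor-`N` curve `V`,
there is a datum `P⋆` of some elliptic `W⋆/ℚ` of conductor `N`, with the same newform, of minimal
degree among all data at level `N` of all conductor-`N` curves with that newform (a minimum over a
nonempty set of naturals) — verbatim the minimality clause of `takahashi2001_thm_2_3_of_coprime`.
[folklore] -/
theorem exists_conductorMinimal {V : WeierstrassCurve ℚ} [V.IsElliptic] {N : ℕ} [NeZero N]
    (D₁ : ModularParametrizationData V N) (hV : V.conductorNorm ℤ = N) :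
    ∃ (Ws : WeierstrassCurve ℚ) (_ : Ws.IsElliptic) (Ps : ModularParametrizationData Ws N),
      Ws.conductorNorm ℤ = N ∧ Ps.f = D₁.f ∧
      ∀ (W' : WeierstrassCurve ℚ) [W'.IsElliptic], W'.conductorNorm ℤ = N →
        ∀ P' : ModularParametrizationData W' N, P'.f = Ps.f →
          Ps.modularDegree ≤ P'.modularDegree := by
  classical
  set S : Set ℕ := {d | ∃ (W' : WeierstrassCurve ℚ) (_ : W'.IsElliptic)
      (P' : ModularParametrizationData W' N),
      W'.conductorNorm ℤ = N ∧ P'.f = D₁.f ∧ P'.modularDegree = d} with hS_def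
  have hS : S.Nonempty := ⟨D₁.modularDegree, V, ‹_›, D₁, hV, rfl, rfl⟩
  obtain ⟨Ws, hWs, Ps, hNs, hfs, hdeg⟩ := Nat.sInf_mem hS
  refine ⟨Ws, hWs, Ps, hNs, hfs, fun W' _ hW' P' hP' => ?_⟩
  rw [hdeg]
  exact Nat.sInf_le ⟨W', ‹_›, P', hW', hP'.trans hfs, rfl⟩

/-! ## The crux from the three named facts -/

/-- **`DefiniteRTControlPrime` from the three vendored named facts** (Takahashi 2001 Thm. 2.3 at
`r ∥ N`; Pasten 2024 §3 p. 13 = Mazur–Kenku degree transport; Pasten 2024 Lemma 6.8), with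
`C = 4 · 163²` and the `N^ε` idle: see the module docstring for the chain
`deg D ≤ 4 deg D₁ ≤ 4·163 deg D₀ ≤ 4·163 deg P⋆ ≤ 4·163 ξ v_q(Δ_min W⋆) ≤ 4·163² ξ v_q(Δ_min E)`.
CONDITIONAL on exactly these three facts (the formal debt of the crux); everything else is proved.
[cite: Takahashi2001, Thm. 2.3 (p. 79), remark p. 80, Thm. 3.8 (p. 84)]
[cite: PastenShimura2024, §3 p. 13 and Lemma 6.8 (p. 22)] -/
theorem definiteRTControlPrime_of_facts (hT : takahashi2001_thm_2_3_of_coprime)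
    (h163 : PastenShimura2024_minimalDegree_le_163_mul) (h68 : PastenShimura2024_lemma_6_8) :
    DefiniteRTControlPrime := by
  intro ε hε
  refine ⟨4 * 163 * 163, ?_⟩
  intro a b hab h0 N _ hN q hq hq2 hqN D hDmin
  -- `N = M q`
  obtain ⟨M, hM⟩ := hqN
  rw [mul_comm] at hM
  subst hM
  haveI := isElliptic_freyCurve h0
  have hdiv : M * q / q = M := Nat.mul_div_cancel M hq.pos
  rw [hdiv]
  have hqN' : q ∣ (freyCurve a b).conductorNorm ℤ := by rw [hN]; exact Dvd.intro_left M rfl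
  -- `gcd(M, q) = 1`
  have hcop : M.Coprime q := by
    have h := stub_freyLocal a b hab h0 q hq hq2 hqN'
    rwa [hN, hdiv] at h
  -- a global minimal model `W_m = C • E`, its data, a minimal one
  obtain ⟨C, hC⟩ := hasGlobalMinimalModel_rat_holds (freyCurve a b)
  haveI := hC
  have hNm : (C • freyCurve a b).conductorNorm ℤ = M * q := by rw [conductorNorm_smul_rat, hN]
  have hne : Nonempty (ModularParametrizationData (C • freyCurve a b) (M * q)) :=
    (Summit.ABC.ABC.Theorems.nonempty_modularParametrizationData_smul_iff C).mpr ⟨D⟩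
  obtain ⟨D₁, -, hD₁min⟩ := exists_minimal_datum hne
  -- the lattice-optimal datum of the class of `f₁ := D₁.f`
  obtain ⟨W₀, hW₀, D₀, hf₀, h₀⟩ := D₁.exists_optimalDatum'
  haveI := hW₀
  have hker₀ : D₀.isogenyMap.ker = ⊥ := D₀.isogenyMap_ker_eq_bot_iff.mpr h₀
  have hmin₀ : ∀ (W' : WeierstrassCurve ℚ) [W'.IsElliptic]
      (D' : ModularParametrizationData W' (M * q)), D'.f = D₀.f →
        D₀.modularDegree ≤ D'.modularDegree := fun W' _ D' hD' =>
    D₀.modularDegree_le_of_isogenyMap_ker_eq_bot hker₀ D' hD'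
  -- (T_deg) `deg D₁ ≤ 163 · deg D₀`
  have h163' : D₁.modularDegree ≤ 163 * D₀.modularDegree :=
    h163 (M * q) W₀ (C • freyCurve a b) D₀ D₁ hf₀.symm hmin₀ hD₁min
  -- the conductor-restricted optimal pivot `(W⋆, P⋆)`
  obtain ⟨Ws, hWs, Ps, hNs, hfs, hPsmin⟩ := exists_conductorMinimal D₁ hNm
  haveI := hWs
  have h0s : D₀.modularDegree ≤ Ps.modularDegree := hmin₀ Ws Ps (hfs.trans hf₀.symm)
  -- Takahashi at `(W⋆, P⋆)`
  have hTak : Ps.modularDegree ≤ brandtXi M q (fun n => Ws.LFunction n) *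
      (Ws.minimalDiscriminantNorm ℤ).factorization q :=
    takahashi2001_thm_2_3_of_coprime.modularDegree_le_brandtXi_mul hT Ws M q hq hcop
      hNs Ps hPsmin
  -- `a(W⋆) = a(f₁) = a(W_m) = a(E)`
  have hL : (fun n => Ws.LFunction n) = fun n => (freyCurve a b).LFunction n := by
    funext n
    have h1 := Ps.isNewformOf.2 n
    have h2 := D₁.isNewformOf.2 n
    rw [hfs] at h1
    rw [h1, LFunction_smul] at h2
    exact_mod_cast h2
  rw [hL] at hTak
  -- (T_val) along `E ~ W_m ~ W⋆`
  have hiso : (freyCurve a b).IsIsogenous Ws :=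
    (isIsogenous_smul (freyCurve a b) C).trans' (isIsogenous_of_f_eq D₁ Ps hfs)
  have hval : (Ws.minimalDiscriminantNorm ℤ).factorization q ≤
      163 * ((freyCurve a b).minimalDiscriminantNorm ℤ).factorization q :=
    stub_valTransport h68 a b hab h0 q hq hq2 hqN' Ws hiso
  -- (T_model) back to the Frey model
  obtain ⟨D₁', -, hdeg₁'⟩ := stub_smulTransportDeg C D₁
  have hscale : (C.u : ℚ).num.natAbs ≤ 2 := stub_freyScale a b hab h0 C hC
  have hD : D.deg ≤ 4 * D₁.modularDegree := by
    calc D.deg ≤ D₁'.deg := hDmin D₁'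
      _ = (C.u : ℚ).num.natAbs ^ 2 * D₁.deg := hdeg₁'
      _ ≤ 2 ^ 2 * D₁.deg := Nat.mul_le_mul_right _ (Nat.pow_le_pow_left hscale 2)
      _ = 4 * D₁.modularDegree := by norm_num [ModularParametrizationData.modularDegree]
  -- the chain in `ℕ`
  set ξ : ℕ := brandtXi M q (fun n => (freyCurve a b).LFunction n) with hξ
  set v : ℕ := ((freyCurve a b).minimalDiscriminantNorm ℤ).factorization q with hv
  have hchain : D.deg ≤ 4 * 163 * 163 * (ξ * v) :=
    calc D.deg ≤ 4 * D₁.modularDegree := hD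
      _ ≤ 4 * (163 * D₀.modularDegree) := Nat.mul_le_mul_left _ h163'
      _ ≤ 4 * (163 * Ps.modularDegree) := Nat.mul_le_mul_left _ (Nat.mul_le_mul_left _ h0s)
      _ ≤ 4 * (163 * (ξ * (Ws.minimalDiscriminantNorm ℤ).factorization q)) :=
          Nat.mul_le_mul_left _ (Nat.mul_le_mul_left _ hTak)
      _ ≤ 4 * (163 * (ξ * (163 * v))) :=
          Nat.mul_le_mul_left _ (Nat.mul_le_mul_left _ (Nat.mul_le_mul_left _ hval))
      _ = 4 * 163 * 163 * (ξ * v) := by ring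
  -- to `ℝ`, inserting the idle `N^ε ≥ 1`
  have hN1 : (1 : ℝ) ≤ ((M * q : ℕ) : ℝ) := by
    exact_mod_cast Nat.one_le_iff_ne_zero.mpr (NeZero.ne (M * q))
  have hrpow : (1 : ℝ) ≤ ((M * q : ℕ) : ℝ) ^ ε := Real.one_le_rpow hN1 hε.le
  have hcast : (D.deg : ℝ) ≤ (4 * 163 * 163 : ℝ) * ((ξ : ℝ) * (v : ℝ)) := by
    exact_mod_cast hchain
  have hξv : (0 : ℝ) ≤ (ξ : ℝ) * (v : ℝ) := by positivity
  calc (D.deg : ℝ) ≤ (4 * 163 * 163 : ℝ) * ((ξ : ℝ) * (v : ℝ)) := hcast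
    _ = (4 * 163 * 163 : ℝ) * 1 * ((ξ : ℝ) * (v : ℝ)) := by ring
    _ ≤ (4 * 163 * 163 : ℝ) * ((M * q : ℕ) : ℝ) ^ ε * ((ξ : ℝ) * (v : ℝ)) := by gcongr

/-! ## The same on the Mazur–Kenku trust base -/

/-- **Variant: Lemma 6.8 replaced by the Mazur–Kenku isogeny theorem.** Pasten's Lemma 6.8 is a
theorem of the tree over the named fact `mazurKenku_exists_cyclic_isogeny` (Mazur 1978, Thm. 1;
Kenku 1982) — `PastenShimura2024_lemma_6_8_of_mazurKenku'` — so the crux also follows from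
Takahashi 2.3, Pasten's `163`-fact and Mazur–Kenku. [cite: Mazur1978, Thm. 1] [cite: Kenku1982] -/
theorem definiteRTControlPrime_of_mazurKenku (hT : takahashi2001_thm_2_3_of_coprime)
    (h163 : PastenShimura2024_minimalDegree_le_163_mul) (hMK : mazurKenku_exists_cyclic_isogeny) :
    DefiniteRTControlPrime :=
  definiteRTControlPrime_of_facts hT h163 (PastenShimura2024_lemma_6_8_of_mazurKenku' hMK)

/-- **Variant: the exact residual beyond Takahashi and Mazur–Kenku.** The `163`-fact is a theorem of
the tree over Mazur–Kenku and ONE unnamed input `hInt` — integrality of every rational multiplier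
`q Λ_f ⊆ Λ_{E'}` into the Néron lattice of a globally minimal parametrised curve (Edixhoven 1991,
Prop. 2 / Stevens 1989: the pull-back of a Néron differential along any modular parametrisation has
integral `q`-expansion), `PastenShimura2024_minimalDegree_le_163_mul_of_mazurKenku` — so the crux
holds given Takahashi 2.3, Mazur–Kenku and `hInt`. [cite: EdixhovenManin1991, Prop. 2] [cite: Mazur1978, Thm. 1] -/
theorem definiteRTControlPrime_of_mazurKenku_of_integrality (hT : takahashi2001_thm_2_3_of_coprime)
    (hMK : mazurKenku_exists_cyclic_isogeny)
    (hInt : ∀ {N : ℕ} [NeZero N] {W' : WeierstrassCurve ℚ} [W'.IsElliptic] [W'.IsGloballyMinimal]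
      (D' : ModularParametrizationData W' N) (q : ℚ),
      (∀ z ∈ periodLattice D'.f, (q : ℂ) * z ∈ D'.L.lattice) → ∃ k : ℤ, (k : ℚ) = q) :
    DefiniteRTControlPrime :=
  definiteRTControlPrime_of_mazurKenku hT
    (PastenShimura2024_minimalDegree_le_163_mul_of_mazurKenku hMK hInt) hMK

end Summit.ABC.ABC.Theorems.DefiniteRTControlPrime

end
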